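import Mathlib.Algebra.MvPolynomial.Division
import Mathlib.RingTheory.MvPolynomial.Homogeneous
import Mathlib.Analysis.SpecialFunctions.Pow.Real
import Mathlib.Analysis.SpecialFunctions.Pow.Asymptotics
import Literature.NumberTheory.Transcendental.RoySmallValueBasic
import Literature.NumberTheory.Transcendental.RoySmallValueEstimates
import Literature.NumberTheory.Transcendental.RoySmallValueEstimatesEndgameAssemblyProofs
import HarnessLib

/-!
# Small value estimates at rational translates (Nguyen–Roy 2016) — proofs, IX: Proposition 4 (the forms `P̃_D`)

Ninth proofs file towards `Literature.NumberTheory.Transcendental.nguyenRoy2016_thm_1` (Nguyen–Roy,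
*A small value estimate in dimension two involving translations by rational points*, IJNT 12 (2016)
= arXiv:1412.5163, Theorem 1). Everything here is PROVED; two auxiliary definitions with bodies
(`homogInt`, `psiInt`), no named facts.

**Proposition 4** of the paper reformulates the hypothesis of Theorem 1 projectively: from the
polynomials `P_D ∈ ℤ[X₁, X₂]` (`deg ≤ D`, `‖P_D‖ ≤ e^{D^β}`, `|P_D(ξ + ir, η sⁱ)| ≤ e^{−D^ν}` for
`0 ≤ i < 4⌊D^σ⌋`) it produces, for `D` large, a homogeneous `P̃_D ∈ ℤ[X₀, X₁, X₂]` of degree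
`D`, divisible neither by `X₀` nor by `X₂`, with `Φⁱ P̃_D ∈ ℤ[X]`, `‖Φⁱ P̃_D‖ ≤ e^{2D^β}` and
`|P̃_D(γ̲_i)| ≤ e^{−D^ν/2}` (`0 ≤ i < 4⌊D^σ⌋`), where `Φ(P)(X) = P(X₀, X₁ + rX₀, sX₂)` and
`γ̲_i = (1, ξ + ir, η sⁱ)`; the printed proof is one sentence: take
`P̃_D(1, X₁, X₂) = m^{4D⌊D^σ⌋} X₁^a X₂^{−b} P_D(X₁, X₂)`, `m` a common denominator of `r, s`, `b` the
largest power of `X₂` dividing `P_D`, `a = D − deg P_D + b`. This file proves it (`NguyenRoy.prop4`),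
with the hypothesis in exactly the Lean form of `nguyenRoy2016_thm_1` and for every `s ≠ 0`
(the paper assumes `|s| > 1` at that point; nothing in Proposition 4 depends on it):

* `exists_eq_X_pow_mul` — `P = X_k^b P'` with `P'` having a monomial free of `X_k`
  (via `MvPolynomial.divMonomial`);
* `homogInt N Q` — the integer homogenisation of `Q ∈ ℤ[X₁, …, X_n]` to degree `N ≥ deg Q`
  (same coefficients; homogeneous; `E(1, z) = Q(z)`; a monomial free of `x₀` when `N = deg Q`;
  `𝓛(E) ≤ #supp(Q) · H(Q)`), an integer variant of `PhilipponMain.exists_homogenization`;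
* `psiInt M U V` — the integral substitution `x₀ ↦ Mx₀`, `x₁ ↦ Mx₁ + Ux₀`, `x₂ ↦ Vx₂`, and
  `map_psiInt`: for `G ∈ ℤ[X]_D`, `psiInt M U V G = M^D · τ_{U/M, V/M}(G)` over `ℂ`
  (homogeneity, `aeval_mul_of_isHomogeneous`) — this is why `m^{iD} Φⁱ(G) ∈ ℤ[X]`
  (`M = mⁱ`, `U = i p m^{i−1}`, `V = qⁱ` for `r = p/m`, `s = q/m`; `exists_intForm_tau`), the
  automorphism `Φⁱ = τ_{(ir, sⁱ)}` being the tree's `Roy2013.tau`;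
* the estimates: `𝓛(τ_{u,v} Q) ≤ (1 + |u| + |v|)^D 𝓛(Q)` is the tree's `Roy2013.l1Norm_tau_le`;
  the bookkeeping `(1 + i|r| + |s|ⁱ)^D m^{4D⌊D^σ⌋} (D+1)² e^{D^β} ≤ e^{2D^β}` and
  `m^{4D⌊D^σ⌋} |ξ + ir|^a |η sⁱ|^{−b} e^{−D^ν} ≤ e^{−D^ν/2}` for `D` large (all the extra factors are
  `e^{O(D^{1+σ})}` and `1 + σ < β`, `1 + σ < ν`) is `height_exp_bound`, `value_exp_bound`.

The naive height `‖·‖` (maximum modulus of the coefficients) of an integer polynomial is the tree's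
`mvPolyHeight` (`RoyCriterion.lean`), as in the statement of `nguyenRoy2016_thm_1`; the length
`𝓛` and maximum norm over `ℂ` are `Nesterenko.l1Norm`, `Nesterenko.maxNorm`.

## References

* [NguyenRoy2016] N. A. V. Nguyen, D. Roy, IJNT 12 (2016) 1273–1293 = arXiv:1412.5163, §2:
  the automorphism `Φ`, the points `γ̲_i`, Proposition 4 and its proof.
* [Roy2013] D. Roy, Mathematika 59 (2013) = arXiv:1301.0663, §3, Lemma 3.1 (`𝓛(τ_γ Q)`), for the
  translation `τ` reused here.
-/

noncomputable section

open MvPolynomial Finset Filter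
open Literature.NumberTheory.Transcendental.Roy2013 (CX tau l1Norm_tau_le)
open Literature.NumberTheory.Transcendental.Nesterenko (l1Norm maxNorm l1Norm_mul_le l1Norm_C
  l1Norm_X l1Norm_pow_le maxNorm_le_l1Norm norm_coeff_le_maxNorm l1Norm_nonneg maxNorm_nonneg)

namespace Literature.NumberTheory.Transcendental

namespace NguyenRoy

/-! ### Scaling a homogeneous polynomial inside `aeval` -/

/-- For `G` homogeneous of degree `D`: `G(cY₁, …, cY_k) = c^D G(Y)` (as elements of any
commutative algebra). [folklore] -/
theorem aeval_mul_of_isHomogeneous {σ R A : Type*} [CommSemiring R] [CommSemiring A] [Algebra R A]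
    {G : MvPolynomial σ R} {D : ℕ} (hG : G.IsHomogeneous D) (c : R) (Y : σ → A) :
    aeval (fun k => algebraMap R A c * Y k) G = algebraMap R A (c ^ D) * aeval Y G := by
  classical
  rw [MvPolynomial.aeval_def, MvPolynomial.aeval_def, eval₂_eq, eval₂_eq, Finset.mul_sum]
  refine Finset.sum_congr rfl fun d hd => ?_
  have hdeg : ∑ i ∈ d.support, d i = D := by
    have h := hG (mem_support_iff.mp hd)
    rw [Finsupp.weight_apply, Finsupp.sum] at h
    simpa using h
  simp only [mul_pow, Finset.prod_mul_distrib]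
  rw [Finset.prod_pow_eq_pow_sum, hdeg, map_pow]
  ring

/-! ### Dividing out the largest power of a variable -/

/-- Every non-zero `P` is `X_k^b · P'` with `P'` having a monomial free of `X_k`; the
coefficients of `P'` are coefficients of `P`, `deg P' ≤ deg P` and `b ≤ deg P`.
[cite: NguyenRoy2016, Proposition 4 (proof: "b is the largest integer such that X₂^b divides P_D")] -/
theorem exists_eq_X_pow_mul {n : ℕ} {P : MvPolynomial (Fin n) ℤ} (hP : P ≠ 0) (k : Fin n) :
    ∃ (b : ℕ) (P' : MvPolynomial (Fin n) ℤ), P = X k ^ b * P' ∧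
      (∀ d, coeff d P' = coeff (Finsupp.single k b + d) P) ∧
      (∃ d ∈ P'.support, d k = 0) ∧ P'.totalDegree ≤ P.totalDegree ∧ b ≤ P.totalDegree ∧
      P'.support.card ≤ P.support.card := by
  classical
  have hne : P.support.Nonempty := support_nonempty.mpr hP
  obtain ⟨d₀, hd₀, hmin⟩ := Finset.exists_min_image P.support (fun d => d k) hne
  set b : ℕ := d₀ k with hb
  set s : Fin n →₀ ℕ := Finsupp.single k b with hs
  set P' : MvPolynomial (Fin n) ℤ := P.divMonomial s with hP'
  have hcoeff : ∀ d, coeff d P' = coeff (s + d) P := fun d => coeff_divMonomial _ _ _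
  have hle : ∀ d ∈ P.support, s ≤ d := by
    intro d hd
    rw [hs, Finsupp.single_le_iff]
    exact hmin d hd
  refine ⟨b, P', ?_, hcoeff, ?_, ?_, ?_, ?_⟩
  · -- `P = X_k^b P'`
    ext d
    rw [X_pow_eq_monomial, coeff_monomial_mul']
    split_ifs with h
    · rw [one_mul, hcoeff, add_tsub_cancel_of_le h]
    · exact notMem_support_iff.mp fun hd => h (hle d hd)
  · -- a monomial of `P'` free of `X_k`
    refine ⟨d₀ - s, ?_, ?_⟩
    · rw [mem_support_iff, hcoeff, add_tsub_cancel_of_le (hle d₀ hd₀)]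
      exact mem_support_iff.mp hd₀
    · simp [hs, hb]
  · -- `deg P' ≤ deg P`
    refine Finset.sup_le fun d hd => ?_
    have hd' : s + d ∈ P.support := by
      rw [mem_support_iff, ← hcoeff]; exact mem_support_iff.mp hd
    refine le_trans ?_ (le_totalDegree hd')
    change Finsupp.degree d ≤ Finsupp.degree (s + d)
    rw [map_add]
    exact Nat.le_add_left _ _
  · -- `b ≤ deg P`
    refine le_trans ?_ (le_totalDegree hd₀)
    change d₀ k ≤ Finsupp.degree d₀
    exact Finsupp.le_degree k d₀
  · -- `#supp P' ≤ #supp P`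
    refine Finset.card_le_card_of_injOn (fun d => s + d) (fun d hd => ?_) ?_
    · rw [Finset.mem_coe, mem_support_iff, ← hcoeff]; exact mem_support_iff.mp hd
    · intro d _ d' _ h
      exact add_left_cancel h

/-! ### Integer homogenisation to a prescribed degree -/

/-- The homogenisation `x₀^{N} Q(x₁/x₀, …, x_n/x₀)` of `Q ∈ ℤ[X₁, …, X_n]` to degree
`N ≥ deg Q`, with integer coefficients (the coefficients of `Q`).
[cite: NguyenRoy2016, Proposition 4 (proof: the homogeneous `P̃_D` with `P̃_D(1, X₁, X₂) = …`)] -/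
def homogInt {n : ℕ} (N : ℕ) (Q : MvPolynomial (Fin n) ℤ) : MvPolynomial (Fin (n + 1)) ℤ :=
  ∑ d ∈ Q.support, monomial (Finsupp.cons (N - d.degree) d) (Q.coeff d)

section homog

variable {n : ℕ} (N : ℕ) (Q : MvPolynomial (Fin n) ℤ)

/-- `|(a, d)| = a + |d|` for exponents. [folklore] -/
theorem degree_cons_eq (a : ℕ) (d : Fin n →₀ ℕ) :
    (Finsupp.cons a d : Fin (n + 1) →₀ ℕ).degree = a + d.degree := by
  rw [Finsupp.degree_eq_sum, Finsupp.degree_eq_sum, Fin.sum_univ_succ]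
  simp [Finsupp.cons_zero, Finsupp.cons_succ]

/-- The exponent lift `d ↦ (N − |d|, d)` is injective. [folklore] -/
theorem cons_sub_injective : Function.Injective
    (fun d : Fin n →₀ ℕ => (Finsupp.cons (N - d.degree) d : Fin (n + 1) →₀ ℕ)) := by
  intro d d' h
  have := congrArg Finsupp.tail h
  simpa [Finsupp.tail_cons] using this

/-- Coefficients of the homogenisation at lifted exponents. [folklore] -/
theorem coeff_homogInt_cons {d : Fin n →₀ ℕ} (hd : d ∈ Q.support) :
    coeff (Finsupp.cons (N - d.degree) d) (homogInt N Q) = Q.coeff d := by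
  classical
  rw [homogInt, coeff_sum]
  simp only [coeff_monomial]
  rw [Finset.sum_eq_single d]
  · rw [if_pos rfl]
  · intro d' _ hne
    rw [if_neg]
    exact fun h => hne (cons_sub_injective N h)
  · exact fun h => absurd hd h

/-- Every exponent in the support of the homogenisation is a lifted exponent. [folklore] -/
theorem exists_of_mem_support_homogInt {e : Fin (n + 1) →₀ ℕ} (he : e ∈ (homogInt N Q).support) :
    ∃ d ∈ Q.support, Finsupp.cons (N - d.degree) d = e ∧ coeff e (homogInt N Q) = Q.coeff d := by
  classical
  have h : coeff e (homogInt N Q) ≠ 0 := mem_support_iff.mp he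
  rw [homogInt, coeff_sum] at h
  simp only [coeff_monomial] at h
  obtain ⟨d, hd, hne⟩ := Finset.exists_ne_zero_of_sum_ne_zero h
  have hde : Finsupp.cons (N - d.degree) d = e := by
    by_contra h'
    rw [if_neg h'] at hne
    exact hne rfl
  refine ⟨d, hd, hde, ?_⟩
  rw [← hde, coeff_homogInt_cons N Q hd]

/-- The homogenisation to degree `N ≥ deg Q` is homogeneous of degree `N`. [folklore] -/
theorem isHomogeneous_homogInt (hN : Q.totalDegree ≤ N) : (homogInt N Q).IsHomogeneous N := by
  refine IsHomogeneous.sum Q.support _ N fun d hd => isHomogeneous_monomial _ ?_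
  rw [degree_cons_eq]
  have : d.degree ≤ N := le_trans (le_totalDegree hd) hN
  omega

/-- `homogInt N Q ≠ 0` for `Q ≠ 0`. [folklore] -/
theorem homogInt_ne_zero (hQ : Q ≠ 0) : homogInt N Q ≠ 0 := by
  obtain ⟨d₀, hd₀⟩ := MvPolynomial.ne_zero_iff.mp hQ
  intro h
  have := coeff_homogInt_cons N Q (mem_support_iff.mpr hd₀)
  rw [h, coeff_zero] at this
  exact hd₀ this.symm

/-- Value of the homogenisation at a point with first coordinate `1`. [folklore] -/
theorem aeval_homogInt {A : Type*} [CommRing A] [Algebra ℤ A] (ω : Fin (n + 1) → A)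
    (hω : ω 0 = 1) : aeval ω (homogInt N Q) = aeval (fun i : Fin n => ω i.succ) Q := by
  classical
  rw [homogInt, map_sum]
  conv_rhs => rw [MvPolynomial.aeval_def, eval₂_eq']
  refine Finset.sum_congr rfl fun d _ => ?_
  rw [aeval_monomial, Finsupp.prod_fintype _ _ (fun i => by simp), Fin.prod_univ_succ]
  simp [Finsupp.cons_zero, Finsupp.cons_succ, hω]

/-- If `N = deg Q` and `Q ≠ 0`, the homogenisation has a monomial free of `x₀`. [folklore] -/
theorem exists_mem_support_homogInt_zero (hQ : Q ≠ 0) (hN : N = Q.totalDegree) :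
    ∃ e ∈ (homogInt N Q).support, e 0 = 0 := by
  classical
  obtain ⟨d₀, hd₀, hmax⟩ := Finset.exists_mem_eq_sup Q.support (support_nonempty.mpr hQ)
    (fun d : Fin n →₀ ℕ => d.sum fun _ e => e)
  refine ⟨Finsupp.cons (N - d₀.degree) d₀, ?_, ?_⟩
  · rw [mem_support_iff, coeff_homogInt_cons N Q hd₀]; exact mem_support_iff.mp hd₀
  · rw [Finsupp.cons_zero, hN, MvPolynomial.totalDegree, hmax, Finsupp.degree_apply]
    exact Nat.sub_self _

/-- A monomial of `Q` free of `X_k` gives a monomial of the homogenisation free of `x_{k+1}`.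
[folklore] -/
theorem exists_mem_support_homogInt_succ {k : Fin n} (h : ∃ d ∈ Q.support, d k = 0) :
    ∃ e ∈ (homogInt N Q).support, e k.succ = 0 := by
  obtain ⟨d, hd, hdk⟩ := h
  refine ⟨Finsupp.cons (N - d.degree) d, ?_, ?_⟩
  · rw [mem_support_iff, coeff_homogInt_cons N Q hd]; exact mem_support_iff.mp hd
  · rw [Finsupp.cons_succ]; exact hdk

/-- `𝓛(homogInt N Q) ≤ #supp(Q) · H(Q)` (over `ℂ`). [folklore] -/
theorem l1Norm_map_homogInt_le :
    l1Norm (map (Int.castRingHom ℂ) (homogInt N Q)) ≤ Q.support.card * mvPolyHeight Q := by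
  classical
  rw [l1Norm]
  have hsupp : (map (Int.castRingHom ℂ) (homogInt N Q)).support ⊆ (homogInt N Q).support :=
    support_map_subset _ _
  calc ∑ γ ∈ (map (Int.castRingHom ℂ) (homogInt N Q)).support,
        ‖(map (Int.castRingHom ℂ) (homogInt N Q)).coeff γ‖
      ≤ ∑ γ ∈ (homogInt N Q).support, ‖(map (Int.castRingHom ℂ) (homogInt N Q)).coeff γ‖ :=
        Finset.sum_le_sum_of_subset_of_nonneg hsupp fun _ _ _ => norm_nonneg _
    _ ≤ ∑ _γ ∈ (homogInt N Q).support, (mvPolyHeight Q : ℝ) := by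
        refine Finset.sum_le_sum fun e he => ?_
        obtain ⟨d, hd, hde, hc⟩ := exists_of_mem_support_homogInt N Q he
        rw [coeff_map, hc, eq_intCast, Complex.norm_intCast, ← Int.cast_abs,
          ← Int.natCast_natAbs, Int.cast_natCast]
        exact_mod_cast natAbs_coeff_le_mvPolyHeight Q d
    _ = (homogInt N Q).support.card * mvPolyHeight Q := by
        rw [Finset.sum_const, nsmul_eq_mul]
    _ ≤ Q.support.card * mvPolyHeight Q := by
        gcongr
        -- the support of the homogenisation injects into that of `Q`
        refine Finset.card_le_card_of_injOn (fun e => Finsupp.tail e) (fun e he => ?_) ?_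
        · obtain ⟨d, hd, hde, -⟩ := exists_of_mem_support_homogInt N Q he
          rw [Finset.mem_coe, ← hde]
          simpa [Finsupp.tail_cons] using hd
        · intro e he e' he' h
          obtain ⟨d, -, hde, -⟩ := exists_of_mem_support_homogInt N Q he
          obtain ⟨d', -, hde', -⟩ := exists_of_mem_support_homogInt N Q he'
          rw [← hde, ← hde'] at h ⊢
          simp only [Finsupp.tail_cons] at h
          rw [h]

end homog

/-! ### The number of monomials of a bivariate polynomial -/

/-- A polynomial in two variables of total degree `≤ D` has at most `(D+1)²` monomials. [folklore] -/
theorem card_support_le_sq (P : MvPolynomial (Fin 2) ℤ) {D : ℕ} (hP : P.totalDegree ≤ D) :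
    P.support.card ≤ (D + 1) ^ 2 := by
  classical
  have hsub : P.support ⊆ (Finset.range (D + 1) ×ˢ Finset.range (D + 1)).image
      (fun p : ℕ × ℕ => Finsupp.single (0 : Fin 2) p.1 + Finsupp.single 1 p.2) := by
    intro d hd
    have hdeg : (d.sum fun _ e => e) ≤ D := (le_totalDegree hd).trans hP
    change Finsupp.degree d ≤ D at hdeg
    rw [Finsupp.degree_eq_sum, Fin.sum_univ_two] at hdeg
    refine Finset.mem_image.mpr ⟨(d 0, d 1), ?_, ?_⟩
    · rw [Finset.mem_product, Finset.mem_range, Finset.mem_range]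
      constructor <;> omega
    · ext i
      fin_cases i <;> simp
  refine (Finset.card_le_card hsub).trans (Finset.card_image_le.trans ?_)
  rw [Finset.card_product, Finset.card_range, sq]

/-! ### The naive height and the maximum norm -/

/-- `H(Q) ≤ |Q|` for the naive height of an integer polynomial and the maximum norm of its image
over `ℂ` (in fact equality). [folklore] -/
theorem mvPolyHeight_le_maxNorm_map {σ : Type*} (Q : MvPolynomial σ ℤ) :
    (mvPolyHeight Q : ℝ) ≤ maxNorm (map (Int.castRingHom ℂ) Q) := by
  classical
  by_cases hQ : Q = 0
  · rw [hQ, mvPolyHeight_zero, Nat.cast_zero]; exact maxNorm_nonneg _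
  obtain ⟨d₀, hd₀, hmax⟩ := Finset.exists_mem_eq_sup Q.support (support_nonempty.mpr hQ)
    (fun m => (Q.coeff m).natAbs)
  have h1 : (mvPolyHeight Q : ℝ) = ‖(map (Int.castRingHom ℂ) Q).coeff d₀‖ := by
    rw [mvPolyHeight, hmax, coeff_map, eq_intCast, Complex.norm_intCast, ← Int.cast_abs,
      ← Int.natCast_natAbs, Int.cast_natCast]
  rw [h1]
  exact norm_coeff_le_maxNorm _ _

/-! ### The translation `Φ` on integer forms: `m^{iD} Φ^i` is integral -/

/-- The integral form of `m^{i deg G} Φ^i(G)`: substitute `x₀ ↦ M x₀`, `x₁ ↦ M x₁ + U x₀`,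
`x₂ ↦ V x₂` (`M = mⁱ`, `U = i p m^{i-1}`, `V = qⁱ` where `r = p/m`, `s = q/m`).
[cite: NguyenRoy2016, §2 (the automorphism Φ) and Proposition 4 ("Φⁱ P̃_D ∈ ℤ[X]")] -/
def psiInt (M U V : ℤ) : MvPolynomial (Fin 3) ℤ →ₐ[ℤ] MvPolynomial (Fin 3) ℤ :=
  aeval ![C M * X 0, C U * X 0 + C M * X 1, C V * X 2]

/-- `psiInt` preserves homogeneity and degree. [folklore] -/
theorem isHomogeneous_psiInt (M U V : ℤ) {G : MvPolynomial (Fin 3) ℤ} {D : ℕ}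
    (hG : G.IsHomogeneous D) : (psiInt M U V G).IsHomogeneous D := by
  have h := hG.aeval (![C M * X 0, C U * X 0 + C M * X 1, C V * X 2] :
    Fin 3 → MvPolynomial (Fin 3) ℤ) (n := 1) ?_
  · simpa [psiInt] using h
  · intro i
    fin_cases i
    · exact (isHomogeneous_C_mul_X _ _)
    · exact (isHomogeneous_C_mul_X _ _).add (isHomogeneous_C_mul_X _ _)
    · exact (isHomogeneous_C_mul_X _ _)

/-- **`m^{iD} Φ^i` is integral on forms of degree `D`**: over `ℂ`,
`psiInt (mⁱ) (u mⁱ) (v mⁱ)… = m^{iD} · τ_{u,v}(G)`; precisely, for `G ∈ ℤ[X]_D`, integers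
`M ≠ 0`, `U`, `V`: `map (psiInt M U V G) = M^D · τ_{U/M, V/M}(map G)`.
[cite: NguyenRoy2016, Proposition 4 (proof)] -/
theorem map_psiInt (M U V : ℤ) (hM : M ≠ 0) {G : MvPolynomial (Fin 3) ℤ} {D : ℕ}
    (hG : G.IsHomogeneous D) :
    map (Int.castRingHom ℂ) (psiInt M U V G) =
      C ((M : ℂ) ^ D) * tau ((U : ℂ) / M) ((V : ℂ) / M) (map (Int.castRingHom ℂ) G) := by
  have hM' : (M : ℂ) ≠ 0 := by exact_mod_cast hM
  rw [psiInt, MvPolynomial.aeval_eq_bind₁, map_bind₁, tau, MvPolynomial.aeval_eq_bind₁]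
  have hG' : (map (Int.castRingHom ℂ) G).IsHomogeneous D := hG.map _
  have key := aeval_mul_of_isHomogeneous hG' (M : ℂ)
    (![X 0, C ((U : ℂ) / M) * X 0 + X 1, C ((V : ℂ) / M) * X 2] : Fin 3 → MvPolynomial (Fin 3) ℂ)
  rw [MvPolynomial.aeval_eq_bind₁, MvPolynomial.aeval_eq_bind₁] at key
  simp only [MvPolynomial.algebraMap_eq] at key
  have hfun : (fun i : Fin 3 => map (Int.castRingHom ℂ)
      ((![C M * X 0, C U * X 0 + C M * X 1, C V * X 2] : Fin 3 → MvPolynomial (Fin 3) ℤ) i)) =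
      fun k => C (M : ℂ) * (![X 0, C ((U : ℂ) / M) * X 0 + X 1, C ((V : ℂ) / M) * X 2] :
        Fin 3 → MvPolynomial (Fin 3) ℂ) k := by
    funext i
    fin_cases i
    · simp
    · simp
      rw [← map_intCast (C : ℂ →+* MvPolynomial (Fin 3) ℂ) M,
        ← map_intCast (C : ℂ →+* MvPolynomial (Fin 3) ℂ) U, mul_add, ← mul_assoc, ← C_mul,
        mul_div_cancel₀ _ hM']
    · simp
      rw [← map_intCast (C : ℂ →+* MvPolynomial (Fin 3) ℂ) M,
        ← map_intCast (C : ℂ →+* MvPolynomial (Fin 3) ℂ) V, ← mul_assoc, ← C_mul,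
        mul_div_cancel₀ _ hM']
  rw [hfun]
  exact key

/-! ### Elementary exponential estimates -/

/-- For `x ≥ 0`, `i ≤ N`: `xⁱ ≤ exp(N log max(1, x))`. [folklore] -/
theorem pow_le_exp_mul_log_max {x : ℝ} (hx : 0 ≤ x) {i : ℕ} {N : ℝ} (hiN : (i : ℝ) ≤ N) :
    x ^ i ≤ Real.exp (N * Real.log (max 1 x)) := by
  have hM1 : 1 ≤ max 1 x := le_max_left _ _
  have hMpos : 0 < max 1 x := by linarith
  have hlog : 0 ≤ Real.log (max 1 x) := Real.log_nonneg hM1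
  calc x ^ i ≤ (max 1 x) ^ i := pow_le_pow_left₀ hx (le_max_right _ _) i
    _ = Real.exp (i * Real.log (max 1 x)) := by
        rw [Real.exp_nat_mul, Real.exp_log hMpos]
    _ ≤ Real.exp (N * Real.log (max 1 x)) :=
        Real.exp_le_exp.mpr (mul_le_mul_of_nonneg_right hiN hlog)

/-- The norm factor of Proposition 4: `(1 + iR + xⁱ)^D ≤ exp(D(1 + N(R + log max(1,x))))` for
`i ≤ N`, `R, x ≥ 0`. [cite: NguyenRoy2016, Proposition 4 (proof, "‖Φⁱ P̃_D‖ ≤ e^{2D^β}")] -/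
theorem norm_factor_le {R x N : ℝ} (hR : 0 ≤ R) (hx : 0 ≤ x) (hN : 0 ≤ N) {i D : ℕ}
    (hiN : (i : ℝ) ≤ N) :
    (1 + i * R + x ^ i) ^ D ≤ Real.exp (D * (1 + N * (R + Real.log (max 1 x)))) := by
  have hlog : 0 ≤ Real.log (max 1 x) := Real.log_nonneg (le_max_left _ _)
  have h1 : 1 + i * R ≤ Real.exp (N * R) := by
    have := Real.add_one_le_exp (i * R)
    have h2 : Real.exp (i * R) ≤ Real.exp (N * R) :=
      Real.exp_le_exp.mpr (mul_le_mul_of_nonneg_right hiN hR)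
    linarith
  have h2 : x ^ i ≤ Real.exp (N * Real.log (max 1 x)) := pow_le_exp_mul_log_max hx hiN
  have h3 : 1 + i * R + x ^ i ≤ Real.exp (1 + N * (R + Real.log (max 1 x))) := by
    have e1 : Real.exp (N * R) ≤ Real.exp (N * (R + Real.log (max 1 x))) :=
      Real.exp_le_exp.mpr (by nlinarith)
    have e2 : Real.exp (N * Real.log (max 1 x)) ≤ Real.exp (N * (R + Real.log (max 1 x))) :=
      Real.exp_le_exp.mpr (by nlinarith)
    have e3 : (2 : ℝ) ≤ Real.exp 1 := by
      have := Real.add_one_le_exp (1 : ℝ); norm_num at this; linarith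
    calc 1 + i * R + x ^ i ≤ 2 * Real.exp (N * (R + Real.log (max 1 x))) := by linarith
      _ ≤ Real.exp 1 * Real.exp (N * (R + Real.log (max 1 x))) :=
          mul_le_mul_of_nonneg_right e3 (Real.exp_pos _).le
      _ = Real.exp (1 + N * (R + Real.log (max 1 x))) := by rw [Real.exp_add]
  have h0 : 0 ≤ 1 + i * R + x ^ i := by positivity
  calc (1 + i * R + x ^ i) ^ D ≤ (Real.exp (1 + N * (R + Real.log (max 1 x)))) ^ D :=
        pow_le_pow_left₀ h0 h3 D
    _ = Real.exp (D * (1 + N * (R + Real.log (max 1 x)))) := by rw [← Real.exp_nat_mul]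

/-- `m^{4DT} ≤ exp(4 D^{1+σ} log m)` for `T ≤ D^σ`, `m ≥ 1`. [folklore] -/
theorem pow_denominator_le {σ : ℝ} {m D T : ℕ} (hm : 1 ≤ (m : ℝ)) (hD : 1 ≤ D)
    (hT : (T : ℝ) ≤ (D : ℝ) ^ σ) :
    (m : ℝ) ^ (4 * D * T) ≤ Real.exp (4 * (D : ℝ) ^ (1 + σ) * Real.log m) := by
  have hDpos : (0 : ℝ) < D := by exact_mod_cast hD
  have hmpos : (0 : ℝ) < m := by linarith
  have hLm0 : 0 ≤ Real.log m := Real.log_nonneg hm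
  have hDT : (D : ℝ) * T ≤ (D : ℝ) ^ (1 + σ) := by
    rw [Real.rpow_add hDpos, Real.rpow_one]
    exact mul_le_mul_of_nonneg_left hT hDpos.le
  have e : (m : ℝ) ^ (4 * D * T) = Real.exp (((4 * D * T : ℕ) : ℝ) * Real.log m) := by
    rw [Real.exp_nat_mul, Real.exp_log hmpos]
  rw [e]
  apply Real.exp_le_exp.mpr
  push_cast
  nlinarith

/-- **The height estimate of Proposition 4** in real form: with `T ≤ D^σ`, `i ≤ 4D^σ` and the
thresholds `6D ≤ D^β`, `8(log m + R + log max(1,x)) D^{1+σ} ≤ D^β`: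
`(1 + iR + xⁱ)^D · m^{4DT} · (D+1)² · e^{D^β} ≤ e^{2D^β}`.
[cite: NguyenRoy2016, Proposition 4 ("‖Φⁱ P̃_D‖ ≤ e^{2D^β}")] -/
theorem height_exp_bound {σ β R x : ℝ} {m i D T : ℕ} (hR : 0 ≤ R) (hx : 0 ≤ x)
    (hm : 1 ≤ (m : ℝ)) (hD : 1 ≤ D) (hT : (T : ℝ) ≤ (D : ℝ) ^ σ) (hi : (i : ℝ) ≤ 4 * (D : ℝ) ^ σ)
    (h1 : 2 * 3 * (D : ℝ) ≤ (D : ℝ) ^ β)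
    (h2 : 2 * (4 * (Real.log m + R + Real.log (max 1 x))) * (D : ℝ) ^ (1 + σ) ≤ (D : ℝ) ^ β) :
    (1 + i * R + x ^ i) ^ D * ((m : ℝ) ^ (4 * D * T) * (((D : ℝ) + 1) ^ 2 * Real.exp ((D : ℝ) ^ β)))
      ≤ Real.exp (2 * (D : ℝ) ^ β) := by
  have hDpos : (0 : ℝ) < D := by exact_mod_cast hD
  have hLm0 : 0 ≤ Real.log m := Real.log_nonneg hm
  have hLs0 : 0 ≤ Real.log (max 1 x) := Real.log_nonneg (le_max_left _ _)
  have hσpos : 0 ≤ (D : ℝ) ^ σ := by positivity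
  have hfac := norm_factor_le hR hx (by positivity : (0 : ℝ) ≤ 4 * (D : ℝ) ^ σ) (D := D) hi
  have hm_exp := pow_denominator_le hm hD hT
  have hD_exp : ((D : ℝ) + 1) ^ 2 ≤ Real.exp (2 * D) := by
    have h := Real.add_one_le_exp (D : ℝ)
    calc ((D : ℝ) + 1) ^ 2 ≤ (Real.exp D) ^ 2 := pow_le_pow_left₀ (by positivity) h 2
      _ = Real.exp (2 * D) := by rw [← Real.exp_nat_mul]; norm_num
  have hDσ : (D : ℝ) * (D : ℝ) ^ σ = (D : ℝ) ^ (1 + σ) := by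
    rw [Real.rpow_add hDpos, Real.rpow_one]
  calc (1 + i * R + x ^ i) ^ D * ((m : ℝ) ^ (4 * D * T) * (((D : ℝ) + 1) ^ 2 * Real.exp ((D : ℝ) ^ β)))
      ≤ Real.exp (D * (1 + 4 * (D : ℝ) ^ σ * (R + Real.log (max 1 x)))) *
          (Real.exp (4 * (D : ℝ) ^ (1 + σ) * Real.log m) *
            (Real.exp (2 * D) * Real.exp ((D : ℝ) ^ β))) := by
        refine mul_le_mul hfac ?_ (by positivity) (by positivity)
        exact mul_le_mul hm_exp (mul_le_mul_of_nonneg_right hD_exp (by positivity))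
          (by positivity) (by positivity)
    _ = Real.exp (D * (1 + 4 * (D : ℝ) ^ σ * (R + Real.log (max 1 x))) +
          4 * (D : ℝ) ^ (1 + σ) * Real.log m + 2 * D + (D : ℝ) ^ β) := by
        simp only [← Real.exp_add]; ring_nf
    _ ≤ Real.exp (2 * (D : ℝ) ^ β) := by
        apply Real.exp_le_exp.mpr
        have e : (D : ℝ) * (1 + 4 * (D : ℝ) ^ σ * (R + Real.log (max 1 x))) =
            D + 4 * (D : ℝ) ^ (1 + σ) * (R + Real.log (max 1 x)) := by
          rw [← hDσ]; ring
        rw [e]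
        have hpow : 0 ≤ (D : ℝ) ^ (1 + σ) := by positivity
        nlinarith

/-- **The value estimate of Proposition 4** in real form: with `T ≤ D^σ`, `i ≤ 4D^σ`,
`a, b ≤ D`, `|x| ≤ |ξ| + iR`, `|y| ≥ min(1,|η|) min(1,|s|)ⁱ`, `|y|^b |P'(x,y)| ≤ e^{−D^ν}` and the
thresholds `4(|ξ| + log⁺|η|⁻¹) D ≤ D^ν`, `16(log m + R + log⁺|s|⁻¹) D^{1+σ} ≤ D^ν`:
`m^{4DT} |x|^a |P'(x,y)| ≤ e^{−D^ν/2}`. [cite: NguyenRoy2016, Proposition 4 ("|P̃_D(γ_i)| ≤ e^{−D^ν/2}")] -/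
theorem value_exp_bound {σ ν R nξ nη ns nx ny nP' : ℝ} {m i D T a b : ℕ}
    (hm : 1 ≤ (m : ℝ)) (hD : 1 ≤ D) (hT : (T : ℝ) ≤ (D : ℝ) ^ σ) (hi : (i : ℝ) ≤ 4 * (D : ℝ) ^ σ)
    (ha : a ≤ D) (hb : b ≤ D) (hR : 0 ≤ R) (hnξ : 0 ≤ nξ) (hnη : 0 < nη) (hns : 0 < ns)
    (hnx0 : 0 ≤ nx) (hnx : nx ≤ nξ + i * R) (hnP' : 0 ≤ nP')
    (hy : min 1 nη * (min 1 ns) ^ i ≤ ny) (hval : ny ^ b * nP' ≤ Real.exp (-(D : ℝ) ^ ν))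
    (h3 : 4 * (nξ + -Real.log (min 1 nη)) * (D : ℝ) ≤ (D : ℝ) ^ ν)
    (h4 : 4 * (4 * (Real.log m + R + -Real.log (min 1 ns))) * (D : ℝ) ^ (1 + σ) ≤ (D : ℝ) ^ ν) :
    (m : ℝ) ^ (4 * D * T) * nx ^ a * nP' ≤ Real.exp (-(D : ℝ) ^ ν / 2) := by
  have hDpos : (0 : ℝ) < D := by exact_mod_cast hD
  have hminη : 0 < min 1 nη := lt_min one_pos hnη
  have hmins : 0 < min 1 ns := lt_min one_pos hns
  set Lη : ℝ := -Real.log (min 1 nη) with hLη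
  set Ls' : ℝ := -Real.log (min 1 ns) with hLs'
  have hLm0 : 0 ≤ Real.log m := Real.log_nonneg hm
  have hLη0 : 0 ≤ Lη := by
    rw [hLη, neg_nonneg]; exact Real.log_nonpos hminη.le (min_le_left _ _)
  have hLs'0 : 0 ≤ Ls' := by
    rw [hLs', neg_nonneg]; exact Real.log_nonpos hmins.le (min_le_left _ _)
  have hDσ : (D : ℝ) * (D : ℝ) ^ σ = (D : ℝ) ^ (1 + σ) := by
    rw [Real.rpow_add hDpos, Real.rpow_one]
  -- lower bound for `|y|^b`
  have hylow : Real.exp (-((D : ℝ) * Lη + 4 * (D : ℝ) ^ (1 + σ) * Ls')) ≤ ny ^ b := by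
    have hy2 : (min 1 nη * (min 1 ns) ^ i) ^ b ≤ ny ^ b := pow_le_pow_left₀ (by positivity) hy b
    refine le_trans ?_ hy2
    rw [mul_pow, ← pow_mul]
    have e1 : Real.exp (-((D : ℝ) * Lη)) ≤ (min 1 nη) ^ b := by
      calc Real.exp (-((D : ℝ) * Lη)) = (min 1 nη) ^ D := by
            rw [hLη, mul_neg, neg_neg, Real.exp_nat_mul, Real.exp_log hminη]
        _ ≤ (min 1 nη) ^ b := pow_le_pow_of_le_one hminη.le (min_le_left _ _) hb
    have e2 : Real.exp (-(4 * (D : ℝ) ^ (1 + σ) * Ls')) ≤ (min 1 ns) ^ (i * b) := by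
      have hib : ((i * b : ℕ) : ℝ) ≤ 4 * (D : ℝ) ^ (1 + σ) := by
        push_cast
        have : (b : ℝ) ≤ D := by exact_mod_cast hb
        calc (i : ℝ) * b ≤ 4 * (D : ℝ) ^ σ * D :=
              mul_le_mul hi this (by positivity) (by positivity)
          _ = 4 * (D : ℝ) ^ (1 + σ) := by rw [← hDσ]; ring
      calc Real.exp (-(4 * (D : ℝ) ^ (1 + σ) * Ls'))
          ≤ Real.exp (-(((i * b : ℕ) : ℝ) * Ls')) := by
            apply Real.exp_le_exp.mpr
            nlinarith
        _ = (min 1 ns) ^ (i * b) := by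
            rw [hLs', mul_neg, neg_neg, Real.exp_nat_mul, Real.exp_log hmins]
    calc Real.exp (-((D : ℝ) * Lη + 4 * (D : ℝ) ^ (1 + σ) * Ls'))
        = Real.exp (-((D : ℝ) * Lη)) * Real.exp (-(4 * (D : ℝ) ^ (1 + σ) * Ls')) := by
          rw [← Real.exp_add]; ring_nf
      _ ≤ (min 1 nη) ^ b * (min 1 ns) ^ (i * b) :=
          mul_le_mul e1 e2 (Real.exp_pos _).le (by positivity)
  -- `|P'(x,y)| ≤ exp(D Lη + 4 D^{1+σ} Ls' - D^ν)`
  have hP'val : nP' ≤ Real.exp ((D : ℝ) * Lη + 4 * (D : ℝ) ^ (1 + σ) * Ls' + -(D : ℝ) ^ ν) := by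
    have hepos : 0 < Real.exp (-((D : ℝ) * Lη + 4 * (D : ℝ) ^ (1 + σ) * Ls')) := Real.exp_pos _
    have h2 : Real.exp (-((D : ℝ) * Lη + 4 * (D : ℝ) ^ (1 + σ) * Ls')) * nP' ≤
        Real.exp (-(D : ℝ) ^ ν) :=
      le_trans (mul_le_mul_of_nonneg_right hylow hnP') hval
    rw [mul_comm, ← le_div_iff₀ hepos, div_eq_mul_inv, ← Real.exp_neg, neg_neg,
      ← Real.exp_add] at h2
    refine h2.trans (le_of_eq ?_)
    ring_nf
  -- `|x|^a ≤ exp(D(|ξ| + 4 D^σ R))`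
  have hxpow : nx ^ a ≤ Real.exp (D * (nξ + 4 * (D : ℝ) ^ σ * R)) := by
    have hx1 : nx ≤ Real.exp (nξ + 4 * (D : ℝ) ^ σ * R) := by
      have i1 : nx ≤ nξ + 4 * (D : ℝ) ^ σ * R := by
        nlinarith [mul_le_mul_of_nonneg_right hi hR]
      linarith [Real.add_one_le_exp (nξ + 4 * (D : ℝ) ^ σ * R)]
    have hbase : 1 ≤ Real.exp (nξ + 4 * (D : ℝ) ^ σ * R) := Real.one_le_exp (by positivity)
    calc nx ^ a ≤ (Real.exp (nξ + 4 * (D : ℝ) ^ σ * R)) ^ a := pow_le_pow_left₀ hnx0 hx1 a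
      _ ≤ (Real.exp (nξ + 4 * (D : ℝ) ^ σ * R)) ^ D := pow_le_pow_right₀ hbase ha
      _ = Real.exp (D * (nξ + 4 * (D : ℝ) ^ σ * R)) := by rw [← Real.exp_nat_mul]
  have hm_exp := pow_denominator_le hm hD hT
  calc (m : ℝ) ^ (4 * D * T) * nx ^ a * nP'
      ≤ Real.exp (4 * (D : ℝ) ^ (1 + σ) * Real.log m) * Real.exp (D * (nξ + 4 * (D : ℝ) ^ σ * R)) *
          Real.exp ((D : ℝ) * Lη + 4 * (D : ℝ) ^ (1 + σ) * Ls' + -(D : ℝ) ^ ν) :=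
        mul_le_mul (mul_le_mul hm_exp hxpow (by positivity) (by positivity)) hP'val hnP'
          (by positivity)
    _ = Real.exp (4 * (D : ℝ) ^ (1 + σ) * Real.log m + D * (nξ + 4 * (D : ℝ) ^ σ * R) +
          ((D : ℝ) * Lη + 4 * (D : ℝ) ^ (1 + σ) * Ls' + -(D : ℝ) ^ ν)) := by
        rw [← Real.exp_add, ← Real.exp_add]
    _ ≤ Real.exp (-(D : ℝ) ^ ν / 2) := by
        apply Real.exp_le_exp.mpr
        have e : (D : ℝ) * (nξ + 4 * (D : ℝ) ^ σ * R) = D * nξ + 4 * (D : ℝ) ^ (1 + σ) * R := by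
          rw [← hDσ]; ring
        rw [e]
        have hpow : 0 ≤ (D : ℝ) ^ (1 + σ) := by positivity
        nlinarith

/-! ### `Φⁱ P̃` as an integer form -/

/-- `τ` commutes with constants. [cite: Roy2013, §3] -/
theorem tau_C_mul (u v x : ℂ) (F : CX) : tau u v (C x * F) = C x * tau u v F := by
  rw [map_mul, algHom_C, MvPolynomial.algebraMap_eq]

/-- **`Φⁱ(m^K G) ∈ ℤ[X]` for `iD ≤ K`**: for `G ∈ ℤ[X]_D`, `m ≥ 1`, `p, q ∈ ℤ`, there is an integer
form `Q` of degree `D` with `Q = τ_{(i p/m, (q/m)ⁱ)}(m^K G)` over `ℂ` (namely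
`Q = m^{K − iD} · psiInt(mⁱ, i p m^{i−1}, qⁱ)(G)`). [cite: NguyenRoy2016, Proposition 4 ("Φⁱ P̃_D ∈ ℤ[X]")] -/
theorem exists_intForm_tau {G : MvPolynomial (Fin 3) ℤ} {D : ℕ} (hG : G.IsHomogeneous D)
    {m : ℕ} (hm : 0 < m) (p q : ℤ) {i K : ℕ} (hiK : i * D ≤ K) :
    ∃ Q : MvPolynomial (Fin 3) ℤ, Q.IsHomogeneous D ∧
      map (Int.castRingHom ℂ) Q = tau ((i : ℂ) * ((p : ℂ) / m)) (((q : ℂ) / m) ^ i)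
        (C ((m : ℂ) ^ K) * map (Int.castRingHom ℂ) G) := by
  have hmC : (m : ℂ) ≠ 0 := by exact_mod_cast hm.ne'
  have hMi0 : ((m : ℤ) ^ i : ℤ) ≠ 0 := pow_ne_zero _ (by exact_mod_cast hm.ne')
  refine ⟨C ((m : ℤ) ^ (K - i * D)) * psiInt ((m : ℤ) ^ i) ((i : ℤ) * p * (m : ℤ) ^ (i - 1)) (q ^ i) G,
    ?_, ?_⟩
  · have := (isHomogeneous_C (Fin 3) ((m : ℤ) ^ (K - i * D))).mul
      (isHomogeneous_psiInt ((m : ℤ) ^ i) ((i : ℤ) * p * (m : ℤ) ^ (i - 1)) (q ^ i) hG)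
    rwa [zero_add] at this
  · have hUM : (((i : ℤ) * p * (m : ℤ) ^ (i - 1) : ℤ) : ℂ) / (((m : ℤ) ^ i : ℤ) : ℂ) =
        (i : ℂ) * ((p : ℂ) / m) := by
      push_cast
      rcases Nat.eq_zero_or_pos i with hi0 | hipos
      · subst hi0; simp
      · obtain ⟨j, rfl⟩ : ∃ j, i = j + 1 := ⟨i - 1, by omega⟩
        simp only [Nat.add_sub_cancel, pow_succ]
        field_simp
    have hVM : ((q ^ i : ℤ) : ℂ) / (((m : ℤ) ^ i : ℤ) : ℂ) = ((q : ℂ) / m) ^ i := by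
      push_cast
      rw [div_pow]
    rw [map_mul, map_C, eq_intCast, map_psiInt _ _ _ hMi0 hG, hUM, hVM, tau_C_mul, ← mul_assoc,
      ← C_mul]
    congr 2
    push_cast
    rw [← pow_mul, ← pow_add, Nat.sub_add_cancel hiK]

/-- **The `ℓ¹`-norm of `Φⁱ P̃`**: for `P̃ = m^K X₁^a E` with `X₁^a E ∈ ℤ[X]_D` and `𝓛(E) ≤ B`:
`𝓛(τ_{u,v} P̃) ≤ (1 + |u| + |v|)^D m^K B`. [cite: NguyenRoy2016, Proposition 4] -/
theorem l1Norm_tau_smul_le {E : MvPolynomial (Fin 3) ℤ} {a K D m : ℕ} (u v : ℂ) {B : ℝ}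
    (hdeg : (X 1 ^ a * E : MvPolynomial (Fin 3) ℤ).IsHomogeneous D)
    (hl1E : l1Norm (map (Int.castRingHom ℂ) E) ≤ B) :
    l1Norm (tau u v (C ((m : ℂ) ^ K) * map (Int.castRingHom ℂ) (X 1 ^ a * E))) ≤
      (1 + ‖u‖ + ‖v‖) ^ D * ((m : ℝ) ^ K * B) := by
  have htot : (C ((m : ℂ) ^ K) * map (Int.castRingHom ℂ) (X 1 ^ a * E)).totalDegree ≤ D := by
    have h := (isHomogeneous_C (Fin 3) ((m : ℂ) ^ K)).mul (hdeg.map (Int.castRingHom ℂ))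
    rw [zero_add] at h
    exact h.totalDegree_le
  refine (l1Norm_tau_le htot u v).trans (mul_le_mul_of_nonneg_left ?_ (by positivity))
  rw [map_mul, map_pow (MvPolynomial.map (Int.castRingHom ℂ)) (X 1 : MvPolynomial (Fin 3) ℤ) a,
    map_X]
  have e1 : l1Norm (C ((m : ℂ) ^ K) : CX) = (m : ℝ) ^ K := by
    rw [l1Norm_C, norm_pow]
    simp
  have e2 : l1Norm ((X 1 : CX) ^ a) ≤ 1 := by
    refine (l1Norm_pow_le _ _).trans ?_
    rw [l1Norm_X, one_pow]
  have hB : 0 ≤ B := (l1Norm_nonneg _).trans hl1E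
  calc l1Norm (C ((m : ℂ) ^ K) * ((X 1 : CX) ^ a * map (Int.castRingHom ℂ) E))
      ≤ l1Norm (C ((m : ℂ) ^ K) : CX) * l1Norm ((X 1 : CX) ^ a * map (Int.castRingHom ℂ) E) :=
        l1Norm_mul_le _ _
    _ ≤ (m : ℝ) ^ K * (l1Norm ((X 1 : CX) ^ a) * l1Norm (map (Int.castRingHom ℂ) E)) := by
        rw [e1]
        exact mul_le_mul_of_nonneg_left (l1Norm_mul_le _ _) (by positivity)
    _ ≤ (m : ℝ) ^ K * (1 * B) := by
        refine mul_le_mul_of_nonneg_left ?_ (by positivity)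
        exact mul_le_mul e2 hl1E (l1Norm_nonneg _) zero_le_one
    _ = (m : ℝ) ^ K * B := by rw [one_mul]

/-- If the coefficients of `P'` are coefficients of `P` then `H(P') ≤ H(P)`. [folklore] -/
theorem mvPolyHeight_le_of_coeff {n : ℕ} {P P' : MvPolynomial (Fin n) ℤ} (s : Fin n →₀ ℕ)
    (h : ∀ d, coeff d P' = coeff (s + d) P) : mvPolyHeight P' ≤ mvPolyHeight P := by
  refine Finset.sup_le fun d _ => ?_
  rw [h]
  exact natAbs_coeff_le_mvPolyHeight P _

/-! ### Proposition 4 -/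

/-- **Proposition 4** (Nguyen–Roy 2016). Let `η ≠ 0`, `r, s ∈ ℚ` with `s ≠ 0`, `1 ≤ σ`,
`β > σ + 1`, `ν > σ + 1`, and suppose that for each large `D` there is `0 ≠ P_D ∈ ℤ[X₁, X₂]` of
total degree `≤ D` and naive height `≤ e^{D^β}` with `|P_D(ξ + ir, η sⁱ)| ≤ e^{−D^ν}` for
`0 ≤ i < 4⌊D^σ⌋` (the hypothesis of Theorem 1). Then for each large `D` there is a homogeneous
`P̃_D ∈ ℤ[X₀, X₁, X₂]` of degree `D`, `≠ 0`, divisible neither by `X₀` nor by `X₂` (it has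
monomials free of `X₀`, resp. `X₂`), such that for `0 ≤ i < 4⌊D^σ⌋`: `Φⁱ P̃_D ∈ ℤ[X]` — an
integer form `Q` of degree `D` with `Q = Φⁱ P̃_D` over `ℂ`, `Φⁱ = τ_{(ir, sⁱ)}`
(`Roy2013.tau`) — with `‖Φⁱ P̃_D‖ ≤ e^{2D^β}` (naive height), and
`|P̃_D(1, ξ + ir, η sⁱ)| ≤ e^{−D^ν/2}`. Construction as printed:
`P̃_D(1, X₁, X₂) = m^{4D⌊D^σ⌋} X₁^a X₂^{−b} P_D(X₁, X₂)`, `m` a common denominator of `r, s`,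
`b` the largest power of `X₂` dividing `P_D`, `a = D − deg P_D + b`; the printed proof assumes
`|s| > 1`, the statement and this proof hold for every `s ≠ 0`.
[cite: NguyenRoy2016, Proposition 4] -/
theorem prop4 {ξ η : ℂ} (hη : η ≠ 0) {r s : ℚ} (hs : s ≠ 0) {σ β ν : ℝ}
    (hσ1 : 1 ≤ σ) (hβ : σ + 1 < β) (hν : σ + 1 < ν)
    (hP : ∀ᶠ D : ℕ in atTop, ∃ P : MvPolynomial (Fin 2) ℤ, P ≠ 0 ∧ P.totalDegree ≤ D ∧
      (mvPolyHeight P : ℝ) ≤ Real.exp ((D : ℝ) ^ β) ∧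
      ∀ i : ℕ, i < 4 * ⌊(D : ℝ) ^ σ⌋₊ →
        ‖aeval ![ξ + (i : ℂ) * (r : ℂ), η * (s : ℂ) ^ i] P‖ ≤ Real.exp (-(D : ℝ) ^ ν)) :
    ∀ᶠ D : ℕ in atTop, ∃ Pt : MvPolynomial (Fin 3) ℤ, Pt.IsHomogeneous D ∧ Pt ≠ 0 ∧
      (∃ e ∈ Pt.support, e 0 = 0) ∧ (∃ e ∈ Pt.support, e 2 = 0) ∧
      ∀ i : ℕ, i < 4 * ⌊(D : ℝ) ^ σ⌋₊ →
        (∃ Q : MvPolynomial (Fin 3) ℤ, Q.IsHomogeneous D ∧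
          map (Int.castRingHom ℂ) Q =
            tau ((i : ℂ) * (r : ℂ)) ((s : ℂ) ^ i) (map (Int.castRingHom ℂ) Pt) ∧
          (mvPolyHeight Q : ℝ) ≤ Real.exp (2 * (D : ℝ) ^ β)) ∧
        ‖aeval ![(1 : ℂ), ξ + (i : ℂ) * (r : ℂ), η * (s : ℂ) ^ i] Pt‖ ≤
          Real.exp (-(D : ℝ) ^ ν / 2) := by
  classical
  -- a common denominator `m` of `r` and `s`: `r = p/m`, `s = q/m`
  obtain ⟨m, p, q, hm0, hpr, hqs⟩ : ∃ (m : ℕ) (p q : ℤ), 0 < m ∧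
      (p : ℂ) / (m : ℂ) = (r : ℂ) ∧ (q : ℂ) / (m : ℂ) = (s : ℂ) := by
    refine ⟨r.den * s.den, r.num * s.den, s.num * r.den, Nat.mul_pos r.den_pos s.den_pos, ?_, ?_⟩
    · rw [Rat.cast_def r]
      have h1 : (r.den : ℂ) ≠ 0 := by exact_mod_cast r.den_ne_zero
      have h2 : (s.den : ℂ) ≠ 0 := by exact_mod_cast s.den_ne_zero
      push_cast
      field_simp
    · rw [Rat.cast_def s]
      have h1 : (r.den : ℂ) ≠ 0 := by exact_mod_cast r.den_ne_zero
      have h2 : (s.den : ℂ) ≠ 0 := by exact_mod_cast s.den_ne_zero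
      push_cast
      field_simp
  have hm1 : (1 : ℝ) ≤ m := by exact_mod_cast hm0
  have hsC : (s : ℂ) ≠ 0 := by exact_mod_cast hs
  have hspos : 0 < ‖(s : ℂ)‖ := norm_pos_iff.mpr hsC
  have hηpos : 0 < ‖η‖ := norm_pos_iff.mpr hη
  -- thresholds
  have ev1 : ∀ᶠ D : ℕ in atTop, (2 * 3) * (D : ℝ) ^ (1 : ℝ) ≤ (D : ℝ) ^ β :=
    EndgameData.eventually_mul_rpow_le_rpow _ (by linarith)
  have ev2 : ∀ᶠ D : ℕ in atTop,
      (2 * (4 * (Real.log m + ‖(r : ℂ)‖ + Real.log (max 1 ‖(s : ℂ)‖)))) * (D : ℝ) ^ (1 + σ) ≤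
        (D : ℝ) ^ β :=
    EndgameData.eventually_mul_rpow_le_rpow _ (by linarith)
  have ev3 : ∀ᶠ D : ℕ in atTop, (4 * (‖ξ‖ + -Real.log (min 1 ‖η‖))) * (D : ℝ) ^ (1 : ℝ) ≤ (D : ℝ) ^ ν :=
    EndgameData.eventually_mul_rpow_le_rpow _ (by linarith)
  have ev4 : ∀ᶠ D : ℕ in atTop,
      (4 * (4 * (Real.log m + ‖(r : ℂ)‖ + -Real.log (min 1 ‖(s : ℂ)‖)))) * (D : ℝ) ^ (1 + σ) ≤
        (D : ℝ) ^ ν :=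
    EndgameData.eventually_mul_rpow_le_rpow _ (by linarith)
  filter_upwards [hP, ev1, ev2, ev3, ev4, eventually_ge_atTop 1] with D hPD h1 h2 h3 h4 hD1
  obtain ⟨P, hP0, hdeg, hH, hval⟩ := hPD
  have hDpos : (0 : ℝ) < D := by exact_mod_cast hD1
  rw [Real.rpow_one] at h1 h3
  have hTσ : ((⌊(D : ℝ) ^ σ⌋₊ : ℕ) : ℝ) ≤ (D : ℝ) ^ σ := Nat.floor_le (by positivity)
  -- Step 1: `P = X₂^b P'`
  obtain ⟨b, P', hPP', hcoeff, hfree, hdeg', hbdeg, hcard⟩ := exists_eq_X_pow_mul hP0 1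
  have hP'0 : P' ≠ 0 := by
    rintro rfl
    rw [mul_zero] at hPP'
    exact hP0 hPP'
  have hN'D : P'.totalDegree ≤ D := hdeg'.trans hdeg
  obtain ⟨a, haN⟩ : ∃ a : ℕ, a + P'.totalDegree = D := ⟨D - P'.totalDegree, by omega⟩
  have haD : a ≤ D := by omega
  have hbD : b ≤ D := hbdeg.trans hdeg
  -- Step 2: `E = homogenisation of P'`, `G = X₁^a E`, `P̃ = m^{4DT} G`
  have hEhom : (homogInt P'.totalDegree P').IsHomogeneous P'.totalDegree :=
    isHomogeneous_homogInt _ P' le_rfl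
  have hGhom : (X 1 ^ a * homogInt P'.totalDegree P' : MvPolynomial (Fin 3) ℤ).IsHomogeneous D := by
    have := (isHomogeneous_X_pow (1 : Fin 3) a).mul hEhom
    rwa [haN] at this
  set K : ℕ := 4 * D * ⌊(D : ℝ) ^ σ⌋₊ with hK
  have hc0 : ((m : ℤ) ^ K : ℤ) ≠ 0 := pow_ne_zero _ (by exact_mod_cast hm0.ne')
  set Pt : MvPolynomial (Fin 3) ℤ := C ((m : ℤ) ^ K) * (X 1 ^ a * homogInt P'.totalDegree P')
    with hPt
  have hPthom : Pt.IsHomogeneous D := by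
    have := (isHomogeneous_C (Fin 3) ((m : ℤ) ^ K)).mul hGhom
    rwa [zero_add] at this
  have hmapPt : map (Int.castRingHom ℂ) Pt =
      C ((m : ℂ) ^ K) * map (Int.castRingHom ℂ) (X 1 ^ a * homogInt P'.totalDegree P') := by
    rw [hPt, map_mul, map_C, eq_intCast, Int.cast_pow, Int.cast_natCast]
  -- support of `P̃`: the monomials `X₁^a · (monomial of E)`
  have hsuppPt : ∀ e ∈ (homogInt P'.totalDegree P').support,
      Finsupp.single (1 : Fin 3) a + e ∈ Pt.support := by
    intro e he
    rw [mem_support_iff, hPt, X_pow_eq_monomial, ← mul_assoc, C_mul_monomial, mul_one,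
      coeff_monomial_mul', if_pos le_self_add, add_tsub_cancel_left]
    exact mul_ne_zero hc0 (mem_support_iff.mp he)
  refine ⟨Pt, hPthom, ?_, ?_, ?_, fun i hi => ⟨?_, ?_⟩⟩
  · -- `P̃ ≠ 0`
    obtain ⟨e, he, -⟩ := exists_mem_support_homogInt_zero _ P' hP'0 rfl
    exact ne_zero_iff.mpr ⟨_, mem_support_iff.mp (hsuppPt e he)⟩
  · -- a monomial free of `X₀`
    obtain ⟨e, he, he0⟩ := exists_mem_support_homogInt_zero _ P' hP'0 rfl
    exact ⟨_, hsuppPt e he, by simp [he0]⟩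
  · -- a monomial free of `X₂`
    obtain ⟨e, he, he2⟩ := exists_mem_support_homogInt_succ P'.totalDegree P' (k := 1) hfree
    refine ⟨_, hsuppPt e he, ?_⟩
    have : ((1 : Fin 2).succ : Fin 3) = 2 := rfl
    rw [this] at he2
    simp [he2]
  · -- `Φⁱ P̃ ∈ ℤ[X]` with height `≤ e^{2D^β}`
    have hi4 : (i : ℝ) ≤ 4 * (D : ℝ) ^ σ := by
      have : (i : ℝ) < 4 * ((⌊(D : ℝ) ^ σ⌋₊ : ℕ) : ℝ) := by exact_mod_cast hi
      linarith
    have hiK : i * D ≤ K := by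
      have : i < 4 * ⌊(D : ℝ) ^ σ⌋₊ := hi
      rw [hK]
      nlinarith
    obtain ⟨Q, hQhom, hQmap⟩ := exists_intForm_tau hGhom hm0 p q hiK
    rw [hpr, hqs, ← hmapPt] at hQmap
    refine ⟨Q, hQhom, hQmap, ?_⟩
    have hl1E : l1Norm (map (Int.castRingHom ℂ) (homogInt P'.totalDegree P')) ≤
        ((D : ℝ) + 1) ^ 2 * Real.exp ((D : ℝ) ^ β) := by
      refine (l1Norm_map_homogInt_le _ P').trans ?_
      have e1 : (P'.support.card : ℝ) ≤ ((D : ℝ) + 1) ^ 2 := by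
        exact_mod_cast hcard.trans (card_support_le_sq P hdeg)
      have e2 : (mvPolyHeight P' : ℝ) ≤ Real.exp ((D : ℝ) ^ β) :=
        le_trans (by exact_mod_cast mvPolyHeight_le_of_coeff _ hcoeff) hH
      exact mul_le_mul e1 e2 (by positivity) (by positivity)
    have hl1 := l1Norm_tau_smul_le ((i : ℂ) * (r : ℂ)) ((s : ℂ) ^ i) (m := m) (K := K) hGhom hl1E
    rw [← hmapPt, ← hQmap, norm_mul, Complex.norm_natCast, norm_pow] at hl1
    calc (mvPolyHeight Q : ℝ) ≤ maxNorm (map (Int.castRingHom ℂ) Q) := mvPolyHeight_le_maxNorm_map Q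
      _ ≤ l1Norm (map (Int.castRingHom ℂ) Q) := maxNorm_le_l1Norm _
      _ ≤ (1 + i * ‖(r : ℂ)‖ + ‖(s : ℂ)‖ ^ i) ^ D *
            ((m : ℝ) ^ K * (((D : ℝ) + 1) ^ 2 * Real.exp ((D : ℝ) ^ β))) := hl1
      _ ≤ Real.exp (2 * (D : ℝ) ^ β) :=
          height_exp_bound (norm_nonneg _) (norm_nonneg _) hm1 hD1 hTσ hi4 h1 h2
  · -- the value at `γ_i`
    have hi4 : (i : ℝ) ≤ 4 * (D : ℝ) ^ σ := by
      have : (i : ℝ) < 4 * ((⌊(D : ℝ) ^ σ⌋₊ : ℕ) : ℝ) := by exact_mod_cast hi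
      linarith
    have hy0 : η * (s : ℂ) ^ i ≠ 0 := mul_ne_zero hη (pow_ne_zero _ hsC)
    -- `P̃(1, x, y) = m^K x^a P'(x, y)` and `P(x, y) = y^b P'(x, y)`
    have htail : (fun j : Fin 2 =>
        (![(1 : ℂ), ξ + (i : ℂ) * (r : ℂ), η * (s : ℂ) ^ i] : Fin 3 → ℂ) j.succ) =
        ![ξ + (i : ℂ) * (r : ℂ), η * (s : ℂ) ^ i] := by
      funext j; fin_cases j <;> rfl
    have hE1 : aeval ![(1 : ℂ), ξ + (i : ℂ) * (r : ℂ), η * (s : ℂ) ^ i] (homogInt P'.totalDegree P') =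
        aeval ![ξ + (i : ℂ) * (r : ℂ), η * (s : ℂ) ^ i] P' := by
      rw [aeval_homogInt _ P' _ rfl, htail]
    have hev : aeval ![(1 : ℂ), ξ + (i : ℂ) * (r : ℂ), η * (s : ℂ) ^ i] Pt =
        ((m : ℂ) ^ K) * (ξ + (i : ℂ) * (r : ℂ)) ^ a *
          aeval ![ξ + (i : ℂ) * (r : ℂ), η * (s : ℂ) ^ i] P' := by
      rw [hPt]
      simp only [map_mul, map_pow, aeval_C, aeval_X, hE1]
      simp
      ring
    have hevP : aeval ![ξ + (i : ℂ) * (r : ℂ), η * (s : ℂ) ^ i] P =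
        (η * (s : ℂ) ^ i) ^ b * aeval ![ξ + (i : ℂ) * (r : ℂ), η * (s : ℂ) ^ i] P' := by
      conv_lhs => rw [hPP']
      rw [map_mul, map_pow, aeval_X]
      rfl
    have hvalP := hval i hi
    rw [hevP, norm_mul, norm_pow] at hvalP
    rw [hev, norm_mul, norm_mul, norm_pow, norm_pow, Complex.norm_natCast]
    refine value_exp_bound (nξ := ‖ξ‖) (R := ‖(r : ℂ)‖) hm1 hD1 hTσ hi4 haD hbD (norm_nonneg _)
      (norm_nonneg _) hηpos hspos (norm_nonneg _) ?_ (norm_nonneg _) ?_ hvalP h3 h4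
    · calc ‖ξ + (i : ℂ) * (r : ℂ)‖ ≤ ‖ξ‖ + ‖(i : ℂ) * (r : ℂ)‖ := norm_add_le _ _
        _ = ‖ξ‖ + i * ‖(r : ℂ)‖ := by rw [norm_mul, Complex.norm_natCast]
    · rw [norm_mul, norm_pow]
      exact mul_le_mul (min_le_right _ _) (pow_le_pow_left₀ (le_min zero_le_one (norm_nonneg _))
        (min_le_right _ _) i) (by positivity) (norm_nonneg _)

end NguyenRoy

end Literature.NumberTheory.Transcendental

end
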